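import Literature.Analysis.Calculus.HadamardLemma
import Mathlib.Analysis.InnerProductSpace.Calculus
import Mathlib.Analysis.SpecialFunctions.SmoothTransition
import HarnessLib

/-!
# The scaled difference quotient `κ⁻¹ (f (κ x) - f 0)`, smoothly through `κ = 0`

Topic `Literature/Analysis/Calculus`. Hadamard's lemma of first order in the scaling variable
(Milnor, *Morse theory* (1963), Lemma 2.1; Hirsch, *Differential Topology* (1976), Ch. 8 §1,
proof of Thm. 1.6, "`F(x, t) = t⁻¹ f(t x)` extends smoothly to `t = 0` by `Df(0) x`"): for a `C^∞`
map `f : E → F`,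

  `scaledDiff f κ x = ∫₀¹ Df((t κ) • x) x dt`

is jointly `C^∞` in `(κ, x)` (`contDiff_scaledDiff`, by differentiation under the integral sign,
`Literature.Analysis.Calculus.contDiff_intervalIntegral`), satisfies
`κ • scaledDiff f κ x = f (κ • x) - f 0` (`smul_scaledDiff`, the fundamental theorem of calculus
along `t ↦ f ((t κ) • x)`), hence equals `κ⁻¹ • (f (κ • x) - f 0)` for `κ ≠ 0`
(`scaledDiff_of_ne_zero`) and `Df(0) x` at `κ = 0` (`scaledDiff_zero_left`). This is the
rescaling ("blow-up") family joining a map to its linearisation at a fixed point, used in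
`Literature/Topology/FourManifolds` to flatten band-sum host loops onto their affine templates.

For maps which are smooth only near `0` we provide the **radial clamp** `ballClamp r` of an inner
product space into the ball of radius `r` (the identity on the ball of radius `r/2`,
`ballClamp_of_norm_le`), so that `ballLocalize f r = f ∘ ballClamp r` is globally `C^∞` as soon as `f`
is `C^∞` on `ball 0 r` (`contDiff_ballLocalize`) and agrees with `f` on `closedBall 0 (r/2)`.

Everything here is proved; no named facts are introduced.

## References

* J. Milnor, *Morse theory*, Annals of Mathematics Studies 51 (1963), Lemma 2.1. [folklore]
* M. W. Hirsch, *Differential Topology*, GTM 33 (1976), Ch. 8 §1, proof of Thm. 1.6. [HirschDT1976]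
-/

noncomputable section

open MeasureTheory Set Function Filter Topology Metric intervalIntegral
open scoped ContDiff

namespace Literature.Analysis.Calculus

variable {E : Type*} [NormedAddCommGroup E] [NormedSpace ℝ E]
variable {F : Type*} [NormedAddCommGroup F] [NormedSpace ℝ F]

/-! ### The scaled difference quotient -/

/-- **The scaled difference quotient** `∫₀¹ Df((t κ) • x) x dt` (`= κ⁻¹ (f (κ x) - f 0)` for
`κ ≠ 0`, `= Df(0) x` for `κ = 0`). [folklore] -/
def scaledDiff (f : E → F) (κ : ℝ) (x : E) : F :=
  ∫ t in (0 : ℝ)..1, fderiv ℝ f ((t * κ) • x) x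

/-- At `κ = 0` the scaled difference quotient is the derivative at `0`. [folklore] -/
theorem scaledDiff_zero_left [CompleteSpace F] (f : E → F) (x : E) : scaledDiff f 0 x = fderiv ℝ f 0 x := by
  simp only [scaledDiff, mul_zero, zero_smul, intervalIntegral.integral_const, sub_zero, one_smul]

/-- **`κ • scaledDiff f κ x = f (κ • x) - f 0`** (fundamental theorem of calculus along
`t ↦ f ((t κ) • x)`). [folklore] -/
theorem smul_scaledDiff [CompleteSpace F] {f : E → F} {n : WithTop ℕ∞} (hf : ContDiff ℝ n f)
    (hn : 1 ≤ n) (κ : ℝ) (x : E) : κ • scaledDiff f κ x = f (κ • x) - f 0 := by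
  have hd : Differentiable ℝ f := hf.differentiable (by positivity)
  -- the path and its derivative
  have hg : ∀ t : ℝ, HasDerivAt (fun t : ℝ ↦ (t * κ) • x) (κ • x) t := fun t ↦ by
    simpa using ((hasDerivAt_id t).mul_const κ).smul_const x
  have hcomp : ∀ t : ℝ, HasDerivAt (fun t : ℝ ↦ f ((t * κ) • x)) (fderiv ℝ f ((t * κ) • x) (κ • x)) t :=
    fun t ↦ (hd ((t * κ) • x)).hasFDerivAt.comp_hasDerivAt t (hg t)
  have hcont : Continuous fun t : ℝ ↦ fderiv ℝ f ((t * κ) • x) (κ • x) := by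
    have h1 : Continuous (fderiv ℝ f) := hf.continuous_fderiv (by positivity)
    exact (h1.comp ((continuous_id.mul continuous_const).smul continuous_const)).clm_apply
      continuous_const
  have hftc := integral_eq_sub_of_hasDerivAt (fun t _ ↦ hcomp t) (hcont.intervalIntegrable 0 1)
  simp only [one_mul, zero_mul, zero_smul] at hftc
  rw [← hftc, scaledDiff, ← intervalIntegral.integral_smul]
  congr 1
  funext t
  rw [map_smul]

/-- For `κ ≠ 0`, `scaledDiff f κ x = κ⁻¹ • (f (κ • x) - f 0)`. [folklore] -/
theorem scaledDiff_of_ne_zero [CompleteSpace F] {f : E → F} {n : WithTop ℕ∞} (hf : ContDiff ℝ n f)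
    (hn : 1 ≤ n) {κ : ℝ} (hκ : κ ≠ 0) (x : E) : scaledDiff f κ x = κ⁻¹ • (f (κ • x) - f 0) := by
  rw [← smul_scaledDiff hf hn κ x, smul_smul, inv_mul_cancel₀ hκ, one_smul]

/-- `f (κ • x) = f 0 + κ • scaledDiff f κ x`. [folklore] -/
theorem apply_smul_eq [CompleteSpace F] {f : E → F} {n : WithTop ℕ∞} (hf : ContDiff ℝ n f)
    (hn : 1 ≤ n) (κ : ℝ) (x : E) : f (κ • x) = f 0 + κ • scaledDiff f κ x := by
  rw [smul_scaledDiff hf hn]; abel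

/-- **The scaled difference quotient is jointly `C^∞` in `(κ, x)`** (differentiation under the
integral sign). [folklore] -/
theorem contDiff_scaledDiff [FiniteDimensional ℝ E] [CompleteSpace F] {f : E → F}
    (hf : ContDiff ℝ ∞ f) : ContDiff ℝ ∞ fun p : ℝ × E ↦ scaledDiff f p.1 p.2 := by
  have h1 : ContDiff ℝ ∞ (fderiv ℝ f) := hf.fderiv_right (m := ∞) le_rfl
  have h2 : ContDiff ℝ ∞ fun q : (ℝ × E) × ℝ ↦ (q.2 * q.1.1) • q.1.2 :=
    (contDiff_snd.mul (contDiff_fst.comp contDiff_fst)).smul (contDiff_snd.comp contDiff_fst)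
  have h3 : ContDiff ℝ ∞ (uncurry fun (p : ℝ × E) (t : ℝ) ↦ fderiv ℝ f ((t * p.1) • p.2) p.2) :=
    (h1.comp h2).clm_apply (contDiff_snd.comp contDiff_fst)
  exact contDiff_intervalIntegral (F := fun (p : ℝ × E) (t : ℝ) ↦ fderiv ℝ f ((t * p.1) • p.2) p.2) h3 0 1

/-- The scaled difference quotient is `C^∞` in `x` for fixed `κ`. [folklore] -/
theorem contDiff_scaledDiff_right [FiniteDimensional ℝ E] [CompleteSpace F] {f : E → F}
    (hf : ContDiff ℝ ∞ f) (κ : ℝ) : ContDiff ℝ ∞ (scaledDiff f κ) :=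
  (contDiff_scaledDiff hf).comp (contDiff_const.prodMk contDiff_id)

/-- The scaled difference quotient is linear-map-natural: for a continuous linear `L`,
`scaledDiff (L ∘ f) κ x = L (scaledDiff f κ x)`. [folklore] -/
theorem scaledDiff_comp_clm [CompleteSpace F] {G : Type*} [NormedAddCommGroup G] [NormedSpace ℝ G]
    [CompleteSpace G] (L : F →L[ℝ] G) {f : E → F} {n : WithTop ℕ∞} (hf : ContDiff ℝ n f) (hn : 1 ≤ n)
    (κ : ℝ) (x : E) : scaledDiff (fun y ↦ L (f y)) κ x = L (scaledDiff f κ x) := by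
  have hd : Differentiable ℝ f := hf.differentiable (by positivity)
  have e : ∀ t : ℝ, fderiv ℝ (fun y ↦ L (f y)) ((t * κ) • x) x = L (fderiv ℝ f ((t * κ) • x) x) := fun t ↦ by
    have h : HasFDerivAt (fun y ↦ L (f y)) ((L : F →L[ℝ] G).comp (fderiv ℝ f ((t * κ) • x))) ((t * κ) • x) :=
      L.hasFDerivAt.comp _ (hd _).hasFDerivAt
    rw [h.fderiv]; rfl
  simp only [scaledDiff, e]
  have hcont : Continuous fun t : ℝ ↦ fderiv ℝ f ((t * κ) • x) x :=
    ((hf.continuous_fderiv (by positivity)).comp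
      ((continuous_id.mul continuous_const).smul continuous_const)).clm_apply continuous_const
  exact (L.intervalIntegral_comp_comm (hcont.intervalIntegrable 0 1))

/-! ### The radial clamp and localisation -/

section Clamp

variable {E : Type*} [NormedAddCommGroup E] [InnerProductSpace ℝ E]

/-- The radial weight `χ_r x = smoothTransition ((r² - ‖x‖²) / (3 r² / 4))`: `1` on
`closedBall 0 (r/2)`, `0` off `ball 0 r`. [folklore] -/
def clampWeight (r : ℝ) (x : E) : ℝ := Real.smoothTransition ((r ^ 2 - ‖x‖ ^ 2) / (3 * r ^ 2 / 4))

/-- The radial weight is `C^∞`. [folklore] -/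
theorem contDiff_clampWeight (r : ℝ) : ContDiff ℝ ∞ (clampWeight (E := E) r) :=
  Real.smoothTransition.contDiff.comp ((contDiff_const.sub (contDiff_norm_sq ℝ)).div_const _)

omit [InnerProductSpace ℝ E] in
/-- The radial weight lies in `[0, 1]`. [folklore] -/
theorem clampWeight_mem (r : ℝ) (x : E) : clampWeight r x ∈ Icc (0 : ℝ) 1 :=
  ⟨Real.smoothTransition.nonneg _, Real.smoothTransition.le_one _⟩

omit [InnerProductSpace ℝ E] in
/-- The radial weight is `1` on `closedBall 0 (r/2)` (`0 < r`). [folklore] -/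
theorem clampWeight_of_norm_le {r : ℝ} (hr : 0 < r) {x : E} (hx : ‖x‖ ≤ r / 2) : clampWeight r x = 1 := by
  apply Real.smoothTransition.one_of_one_le
  rw [le_div_iff₀ (by positivity)]
  have h0 : 0 ≤ ‖x‖ := norm_nonneg x
  nlinarith

omit [InnerProductSpace ℝ E] in
/-- The radial weight vanishes off `ball 0 r`. [folklore] -/
theorem clampWeight_of_le_norm {r : ℝ} (hr : 0 < r) {x : E} (hx : r ≤ ‖x‖) : clampWeight r x = 0 := by
  apply Real.smoothTransition.zero_of_nonpos
  rw [div_nonpos_iff]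
  right
  exact ⟨by nlinarith, by positivity⟩

/-- **The radial clamp** `x ↦ χ_r x • x`. [folklore] -/
def ballClamp (r : ℝ) (x : E) : E := clampWeight r x • x

/-- The radial clamp is `C^∞`. [folklore] -/
theorem contDiff_ballClamp (r : ℝ) : ContDiff ℝ ∞ (ballClamp (E := E) r) :=
  (contDiff_clampWeight r).smul contDiff_id

/-- The radial clamp is the identity on `closedBall 0 (r/2)`. [folklore] -/
theorem ballClamp_of_norm_le {r : ℝ} (hr : 0 < r) {x : E} (hx : ‖x‖ ≤ r / 2) : ballClamp r x = x := by
  rw [ballClamp, clampWeight_of_norm_le hr hx, one_smul]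

/-- The radial clamp maps into `ball 0 r`. [folklore] -/
theorem norm_ballClamp_lt {r : ℝ} (hr : 0 < r) (x : E) : ‖ballClamp r x‖ < r := by
  rcases lt_or_ge ‖x‖ r with h | h
  · have hw := clampWeight_mem r x
    rw [ballClamp, norm_smul, Real.norm_eq_abs, abs_of_nonneg hw.1]
    calc clampWeight r x * ‖x‖ ≤ 1 * ‖x‖ := mul_le_mul_of_nonneg_right hw.2 (norm_nonneg _)
      _ < r := by rw [one_mul]; exact h
  · rw [ballClamp, clampWeight_of_le_norm hr h, zero_smul, norm_zero]; exact hr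

/-- The radial clamp fixes `0`. [folklore] -/
@[simp] theorem ballClamp_zero (r : ℝ) : ballClamp r (0 : E) = 0 := by simp [ballClamp]

/-- **Localisation**: `f ∘ ballClamp r`. [folklore] -/
def ballLocalize (f : E → F) (r : ℝ) (x : E) : F := f (ballClamp r x)

omit [NormedAddCommGroup F] [NormedSpace ℝ F] in
/-- The localisation agrees with `f` on `closedBall 0 (r/2)`. [folklore] -/
theorem ballLocalize_of_norm_le {f : E → F} {r : ℝ} (hr : 0 < r) {x : E} (hx : ‖x‖ ≤ r / 2) :
    ballLocalize f r x = f x := by rw [ballLocalize, ballClamp_of_norm_le hr hx]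

omit [NormedAddCommGroup F] [NormedSpace ℝ F] in
/-- The localisation at `0` is `f 0`. [folklore] -/
@[simp] theorem ballLocalize_zero (f : E → F) (r : ℝ) : ballLocalize f r 0 = f 0 := by simp [ballLocalize]

omit [NormedAddCommGroup F] [NormedSpace ℝ F] in
/-- The localisation agrees with `f` near every point of `ball 0 (r/2)`. [folklore] -/
theorem ballLocalize_eventuallyEq {f : E → F} {r : ℝ} (hr : 0 < r) {x : E} (hx : ‖x‖ < r / 2) :
    ballLocalize f r =ᶠ[𝓝 x] f := by
  have ho : IsOpen (ball (0 : E) (r / 2)) := isOpen_ball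
  filter_upwards [ho.mem_nhds (by simpa using hx)] with y hy
  exact ballLocalize_of_norm_le hr (le_of_lt (by simpa using hy))

/-- **The localisation of a map which is `C^∞` on `ball 0 r` is globally `C^∞`.** [folklore] -/
theorem contDiff_ballLocalize {f : E → F} {r : ℝ} (hr : 0 < r)
    (hf : ContDiffOn ℝ ∞ f (ball 0 r)) : ContDiff ℝ ∞ (ballLocalize f r) :=
  hf.comp_contDiff (contDiff_ballClamp r) fun x ↦ by
    simpa using norm_ballClamp_lt hr x

/-- The derivative of the localisation on `ball 0 (r/2)` is that of `f`. [folklore] -/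
theorem fderiv_ballLocalize {f : E → F} {r : ℝ} (hr : 0 < r) {x : E} (hx : ‖x‖ < r / 2) :
    fderiv ℝ (ballLocalize f r) x = fderiv ℝ f x :=
  (ballLocalize_eventuallyEq hr hx).fderiv_eq

/-- In particular at `0`. [folklore] -/
theorem fderiv_ballLocalize_zero {f : E → F} {r : ℝ} (hr : 0 < r) :
    fderiv ℝ (ballLocalize f r) 0 = fderiv ℝ f 0 :=
  fderiv_ballLocalize hr (by simpa using half_pos hr)

end Clamp

/-! ### The two combined: the scaled difference quotient of a locally smooth map -/

section Local

variable {E : Type*} [NormedAddCommGroup E] [InnerProductSpace ℝ E] [FiniteDimensional ℝ E]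
  [CompleteSpace F]

/-- **Joint smoothness** of `(κ, x) ↦ scaledDiff (ballLocalize f r) κ x` for `f` smooth on `ball 0 r`.
[folklore] -/
theorem contDiff_scaledDiff_ballLocalize {f : E → F} {r : ℝ} (hr : 0 < r) (hf : ContDiffOn ℝ ∞ f (ball 0 r)) :
    ContDiff ℝ ∞ fun p : ℝ × E ↦ scaledDiff (ballLocalize f r) p.1 p.2 :=
  contDiff_scaledDiff (contDiff_ballLocalize hr hf)

omit [FiniteDimensional ℝ E] in
/-- **The rescaling identity near `0`**: for `‖κ • x‖ ≤ r/2`,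
`f (κ • x) = f 0 + κ • scaledDiff (ballLocalize f r) κ x`. [folklore] -/
theorem apply_smul_eq_ballLocalize {f : E → F} {r : ℝ} (hr : 0 < r) (hf : ContDiffOn ℝ ∞ f (ball 0 r))
    {κ : ℝ} {x : E} (h : ‖κ • x‖ ≤ r / 2) :
    f (κ • x) = f 0 + κ • scaledDiff (ballLocalize f r) κ x := by
  have := apply_smul_eq (contDiff_ballLocalize hr hf) (by simp) κ x
  rwa [ballLocalize_of_norm_le hr h, ballLocalize_zero] at this

omit [FiniteDimensional ℝ E] in
/-- For `κ ≠ 0` and `‖κ • x‖ ≤ r/2`: `scaledDiff (ballLocalize f r) κ x = κ⁻¹ • (f (κ • x) - f 0)`.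
[folklore] -/
theorem scaledDiff_ballLocalize_of_ne_zero {f : E → F} {r : ℝ} (hr : 0 < r) (hf : ContDiffOn ℝ ∞ f (ball 0 r))
    {κ : ℝ} (hκ : κ ≠ 0) {x : E} (h : ‖κ • x‖ ≤ r / 2) :
    scaledDiff (ballLocalize f r) κ x = κ⁻¹ • (f (κ • x) - f 0) := by
  rw [scaledDiff_of_ne_zero (contDiff_ballLocalize hr hf) (by simp) hκ, ballLocalize_of_norm_le hr h, ballLocalize_zero]

omit [FiniteDimensional ℝ E] in
/-- At `κ = 0`: `scaledDiff (ballLocalize f r) 0 x = Df(0) x`. [folklore] -/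
theorem scaledDiff_ballLocalize_zero_left {f : E → F} {r : ℝ} (hr : 0 < r) (x : E) :
    scaledDiff (ballLocalize f r) 0 x = fderiv ℝ f 0 x := by
  rw [scaledDiff_zero_left, fderiv_ballLocalize_zero hr]

end Local

end Literature.Analysis.Calculus

end
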